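import Summits.QuantumFields.YangMills.Theorems.BalabanUVNodesN16HolderAtRecord12
import Summits.QuantumFields.YangMills.Theorems.BalabanUVNodesN16SlotWindowLinear
import Summits.QuantumFields.YangMills.Theorems.BalabanUVNodesN16HolderLeafSlot
import HarnessLib

/-!
# Route «BalabanUVNodes», cluster K4 «SpineRates» — node N16 = NE3: THE HOLDER STUB FROM THE HOLDER SLOT AT THE HOMES OF RECORD — slot closers at exponent `β`
# (`InEndRegimeH ∧ LeafSlotHolder · β` once per family ⇒ `S_N16Holder β (RRec₁₂On ∕ RRec₁₂ …)`), THE WINDOW RECIPE AT EXPONENT `β` (the class radius inside N05's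
# window makes `LeafSlotHolder · β` its three content clauses — N05's leaf on `zdGF3 (M_N ℂ) F.L β len`, N07's `LeafH3sup`), the H-proviso at windowed letters, THE N16
# LINE AT EXPONENT `β` at the reading of record, and its letter-wise non-vacuity at the H-thresholds

Cell `pub-ymgap`, seat `pub-ymgap-dag-n16-e` (R134 acceleration seat (a), strategy s2 = BY-NAME KNIT at the record; HUMAN RULING D-0062; chair R424 venue),
generation 4, file 16 (THEOREMS ONLY, 0 `def`, 0 `sorry`, standard axioms).  `bears_on: R4∕N16 · K3′ SpineGivenEndpointR12 (stmt-QuantumFields-19908)`.  Filed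
`--supports stmt-QuantumFields-19908 --as helper`.  Imports this seat's file 15 `BalabanUVNodesN16HolderAtRecord12` (p482004: `s_N16Holder_rRec₁₂On_iff_of_constLayer`, `s_N16Holder_rRec₁₂_iff_of_constLayer`), file 17
`BalabanUVNodesN16SlotWindowLinear` (the slot-free arithmetic `slotLetterLines`, `leafLines_of_linear`) and dag-n16-c's (E1) `BalabanUVNodesN16HolderRegime` (p482644:
`InEndRegimeH`, `radiusOfRecordH`, `constOfRecordH`) ∕ (E2) `BalabanUVNodesN16HolderLeafSlot` (`LeafSlotHolder`, `n16HolderAt_of_inEndRegimeH_leafSlotHolder`).  Restates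
nothing; cites by name.

WHY (dag-n16-c LOCATED-N16-HOLDER-PIN, repair R-β: this seat's ANSWER-N16C (E)∕(F), pub-ymgap INBOX l.15006 ∕ INTENT-15 l.15044).  File 15 gave the Holder stub's
home-side faces; (E) gives the bundle-level packaging at exponent β (slots, H-thresholds, proviso, closers).  THIS FILE joins them: the β-twins of files 8 ∕ 12 §5–§6
(slot ⇒ stub at the homes), of file 13 §2–§3 (the window recipe, the proviso at windowed letters, non-vacuity) and of file 14 (the N16 line at the reading of record).
At `β = 1` the slot statements are those of record (`leafSlotHolder_one_iff`); the thresholds are (E)'s β-uniform `radiusOfRecordH` ∕ `constOfRecordH`.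

CONTENT ([folklore] bookkeeping; the real arithmetic is file 17's two slot-free lemmas, β-free).
§1 `s_N16Holder_rRec₁₂On_of_constLayer_leafSlotHolder` ∕ `s_N16Holder_rRec₁₂_of_constLayer_leafSlotHolder` (`0 ≤ β ≤ 1`; proviso `InEndRegimeH` + `LeafSlotHolder · β` at
   the ONE bundle of every guarded family ∕ family with a datum of record ⇒ the Holder stub); at the reading of record
   `s_N16Holder_rRec₁₂On_readingOfRecord₁₂_of_leafSlotHolder` ∕ `s_N16Holder_rRec₁₂_readingOfRecord₁₂_of_leafSlotHolder`.
§2 `leafSlotHolder_ofRecord_of_window_lines` (LINE-EXACT: the slot's four `(b', c')`-lines as hypotheses) and `…_of_window_linear` (dag-ref-B READ-445's LINEAR recipe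
   `0 ≤ b' ≤ α∕2048`, `c' ≤ α∕24`) — file 17 §2 at exponent β (content family `zdGF3 (M_N ℂ) F.L β len`; the window lines are β-free); at `β = 1` these ARE file 17's
   (`leafSlotHolder_one_iff`); `inEndRegimeH_ofRecord_of_window` — the H-proviso at windowed letters (`Λ₁ ≤ radiusOfRecordH`, `constOfRecordH ≤ C`).
§3 `s_N16Holder_rRec₁₂On_readingOfRecord₁₂_of_window_linear` ∕ `s_N16Holder_rRec₁₂_readingOfRecord₁₂_of_window_linear` — THE N16 LINE AT EXPONENT `β ∈ [0, 1]`, linear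
   currency: windowed letters (H-thresholds) + the three content clauses once per family ⇒ `S_N16Holder β (RRec₁₂On ∕ RRec₁₂ (readingOfRecord₁₂ w1 ℓ ne2 ne1) …)`.
§4 `exists_window_letters_numerals_H` — windowed letters meeting ALL of §3's lines with `ℓ.Λ₁ = radiusOfRecordH …`, `ℓ.C = constOfRecordH …`, `0 < ℓ.b`,
   `0 < ℓ.Λ₂'`, `InEndRegimeH` at RR-1's object AND dag-n21-d's numeral `512·(4+1)·(4+4)·L²·ℓ.b ≤ 1` EXIST.

HONEST FRAMING.  Kernel bookkeeping + real arithmetic; the three content clauses are HYPOTHESES (N05's leaf AT ITS RESIDUAL EXPONENT β on the univ sub-family of `zdGF3`,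
modulo its sockets; N07's [Balaban1985Variational] Thm 1 (8)+(10) TYPE), asserted for no family; `S_N16Holder β` ∕ `LeafSlotHolder` ∕ `InEndRegimeH` are CANDIDATE wordings
for repair R-β (R-β ∕ R-Δ ∕ R-min UNRULED — planner ∕ director); nothing of record edited; no inhabitant of `IsDatumOfRecord₁₂C` claimed (K0′ open); **N16 ∕ NE3 NOT
discharged**; count-neutral; one finite four-torus at fixed ε — NOT ℝ⁴, NOT infinite volume, NOT OS, NOT a mass gap, NOT Clay.
-/

set_option autoImplicit false

open scoped BigOperators Matrix Matrix.Norms.L2Operator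
open NormedSpace

namespace Summit.QuantumFields.YangMills.BalabanUVNodes.N16HolderSlotWindow

open Literature.MathematicalPhysics.QuantumFieldTheory.Balaban1983to89
open Literature.MathematicalPhysics.QuantumFieldTheory.Balaban1983to89.T4Continuum (T4Family ULoop)
open B7Prop1Explicit B7Prop2Explicit
open B7Prop3Flat (c3)
open B8LeafModelZd (ZdIdx)
open B8LeafModelZd3 (zdGF3)
open Node00 (IsDatumOfRecord₁₂C Stage12Params NE3Objects₁₁ NE3Letters₁₁ NE2Objects₁₁ ne3ConstLayerOfRecord₁₁ ne3NperOfRecord₁₁ ne3DomOfRecord₁₁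
  one_le_ne3NperOfRecord₁₁)
open Summit.QuantumFields.BalabanUV.T4Continuum
open BlockAverageCurrent (curConst curConst_nonneg)
open NE3RightInverseSupLetters (frameC)
open NE3.LeafIndexSockets (LeafH3sup)
open YMDAG.UVSplit (Datum NE3Carriers NE1pCarriers ne3OfRecord₁₁ RateReading₁₂ RRec₁₂ RRec₁₂On readingOfRecord₁₂)
open Summit.QuantumFields.YangMills.BalabanUVNodes.N16HolderDefs (N16HolderAt S_N16Holder)
open Summit.QuantumFields.YangMills.BalabanUVNodes.N16HolderRegime (InEndRegimeH radiusOfRecordH constOfRecordH inEndRegimeH_iff radiusOfRecordH_pos constOfRecordH_nonneg)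
open Summit.QuantumFields.YangMills.BalabanUVNodes.N16HolderLeafSlot (LeafSlotHolder n16HolderAt_of_inEndRegimeH_leafSlotHolder)
open Summit.QuantumFields.YangMills.BalabanUVNodes.N16SlotWindowLinear (slotLetterLines leafLines_of_linear)
open Summit.QuantumFields.YangMills.BalabanUVNodes.N16HolderAtRecord12 (s_N16Holder_rRec₁₂On_iff_of_constLayer s_N16Holder_rRec₁₂_iff_of_constLayer)

noncomputable section

variable {N : ℕ} [NeZero N]

/-! ## §1 The Holder stub from the H-proviso and the Holder slot at ONE bundle per family -/

section ConstLayer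

variable {β : ℝ} (hβ0 : 0 ≤ β) (hβ1 : β ≤ 1) (𝔯 : RateReading₁₂ N) (Rg : (F : T4Family) → Stage12Params F N → Prop) (o : T4Family → NE3Objects₁₁ N)
include hβ0 hβ1

/-- **THE KNIT AT A CONSTANT LAYER, HOLDER LEAF FORM, REGIME-RESTRICTED HOME** (`0 ≤ β ≤ 1`): for a reading whose NE3 component is constantly `o F`, the H-proviso
`InEndRegimeH` and the Holder slot `LeafSlotHolder · β` at the ONE bundle `ne3OfRecord₁₁ F (o F)` of every guarded family give `S_N16Holder β (RRec₁₂On 𝔯 Rg)` ((E)'s closer once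
per family). [folklore] -/
theorem s_N16Holder_rRec₁₂On_of_constLayer_leafSlotHolder
    (hpin : ∀ (F : T4Family) (θ : Stage12Params F N) (hP : θ.Provisos₁₂ F N) (g₀ : ℕ → ℝ) (os : List (ULoop F)) (k : ℕ), (𝔯.lit F θ hP g₀ os).ne3 k = o F)
    (h : ∀ (F : T4Family), (∃ θ : Stage12Params F N, θ.Provisos₁₂ F N ∧ Rg F θ ∧ θ.Admissible F N) →
      InEndRegimeH (ne3OfRecord₁₁ F (o F)) ∧ LeafSlotHolder (ne3OfRecord₁₁ F (o F)) β) :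
    S_N16Holder β (RRec₁₂On 𝔯 Rg) :=
  (s_N16Holder_rRec₁₂On_iff_of_constLayer β 𝔯 Rg o hpin).2 fun F hF => n16HolderAt_of_inEndRegimeH_leafSlotHolder (h F hF).1 hβ0 hβ1 (h F hF).2

/-- **THE KNIT AT A CONSTANT LAYER, HOLDER LEAF FORM, CANONICAL HOME** (`0 ≤ β ≤ 1`). [folklore] -/
theorem s_N16Holder_rRec₁₂_of_constLayer_leafSlotHolder
    (hpin : ∀ (F : T4Family) (θ : Stage12Params F N) (hP : θ.Provisos₁₂ F N) (g₀ : ℕ → ℝ) (os : List (ULoop F)) (k : ℕ), (𝔯.lit F θ hP g₀ os).ne3 k = o F)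
    (h : ∀ (F : T4Family), (∃ D : Datum F N, IsDatumOfRecord₁₂C F N D) → InEndRegimeH (ne3OfRecord₁₁ F (o F)) ∧ LeafSlotHolder (ne3OfRecord₁₁ F (o F)) β) :
    S_N16Holder β (RRec₁₂ 𝔯) :=
  (s_N16Holder_rRec₁₂_iff_of_constLayer β 𝔯 o hpin).2 fun F hF => n16HolderAt_of_inEndRegimeH_leafSlotHolder (h F hF).1 hβ0 hβ1 (h F hF).2

variable (w1 : (F : T4Family) → (θ : Stage12Params F N) → Node00.W1.ReadingData F (Node00.MatA N) θ.τ9.M) (ℓ₃ : T4Family → NE3Letters₁₁)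
  (ne2 : (F : T4Family) → Stage12Params F N → (ℕ → ℝ) → List (ULoop F) → ℕ → NE2Objects₁₁)
  (ne1 : (F : T4Family) → Stage12Params F N → (ℕ → ℝ) → List (ULoop F) → NE1pCarriers)

/-- **THE KNIT AT THE READING OF RECORD, HOLDER LEAF FORM, REGIME-RESTRICTED** (`0 ≤ β ≤ 1`; `hpin := rfl`). [folklore] -/
theorem s_N16Holder_rRec₁₂On_readingOfRecord₁₂_of_leafSlotHolder
    (h : ∀ (F : T4Family), (∃ θ : Stage12Params F N, θ.Provisos₁₂ F N ∧ Rg F θ ∧ θ.Admissible F N) →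
      InEndRegimeH (ne3OfRecord₁₁ F (ne3ConstLayerOfRecord₁₁ F N (ℓ₃ F))) ∧ LeafSlotHolder (ne3OfRecord₁₁ F (ne3ConstLayerOfRecord₁₁ F N (ℓ₃ F))) β) :
    S_N16Holder β (RRec₁₂On (readingOfRecord₁₂ w1 ℓ₃ ne2 ne1) Rg) :=
  s_N16Holder_rRec₁₂On_of_constLayer_leafSlotHolder hβ0 hβ1 _ Rg (fun F => ne3ConstLayerOfRecord₁₁ F N (ℓ₃ F)) (fun _ _ _ _ _ _ => rfl) h

/-- **THE KNIT AT THE READING OF RECORD, HOLDER LEAF FORM, CANONICAL HOME** (`0 ≤ β ≤ 1`). [folklore] -/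
theorem s_N16Holder_rRec₁₂_readingOfRecord₁₂_of_leafSlotHolder
    (h : ∀ (F : T4Family), (∃ D : Datum F N, IsDatumOfRecord₁₂C F N D) →
      InEndRegimeH (ne3OfRecord₁₁ F (ne3ConstLayerOfRecord₁₁ F N (ℓ₃ F))) ∧ LeafSlotHolder (ne3OfRecord₁₁ F (ne3ConstLayerOfRecord₁₁ F N (ℓ₃ F))) β) :
    S_N16Holder β (RRec₁₂ (readingOfRecord₁₂ w1 ℓ₃ ne2 ne1)) :=
  s_N16Holder_rRec₁₂_of_constLayer_leafSlotHolder hβ0 hβ1 _ (fun F => ne3ConstLayerOfRecord₁₁ F N (ℓ₃ F)) (fun _ _ _ _ _ _ => rfl) h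

end ConstLayer

/-! ## §2 The window recipe at exponent `β` (line-exact, linear); the H-proviso at windowed letters -/

omit [NeZero N] in
/-- **THE WINDOW RECIPE AT EXPONENT `β`, LINE-EXACT** — `LeafSlotHolder · β` AT RR-1's OBJECT FROM ITS THREE CONTENT CLAUSES (file 17's `leafSlot_ofRecord_of_window_lines`
with N05's family at `zdGF3 (M_N ℂ) F.L β len`): N07's leaf letters enter only through the slot's four displayed `(b', c')`-lines; `o.ε < α` free; the eleven derived
numeric lines are file 17's `slotLetterLines`. [folklore] -/
theorem leafSlotHolder_ofRecord_of_window_lines (F : T4Family) (o : NE3Objects₁₁ N) {β : ℝ}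
    {len : Site 4 → ℝ} (hlen : ∀ v : Site 4, 0 < len v → 1 ≤ len v) (hlen1 : ∀ μ : Fin 4, len (e μ) = 1)
    {c₁ c₁' B₁' cP C₂ B₀β : ℝ} {inp : B8.B9Inputs} (hB₁' : 0 < B₁') (hBB : 5 * ((4 : ℕ) : ℝ) * F.L * inp.B₀ ≤ B₁') (hc₁' : 0 < c₁')
    (hwin : ∀ α₀ α₁ : ℝ, 0 < α₀ → 0 < α₁ → α₀ + α₁ ≤ c₁' →
      α₀ + α₁ ≤ c₁ ∧ C0 4 * (2 * α₀) ≤ 1 / 3 ∧ 4 * α₀ ≤ c2' 4 F.L ∧ 16 * (B₁' * (α₀ + α₁)) ≤ 1 ∧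
      Real.exp (4 * (800 * (((4 : ℕ) : ℝ) + 1) ^ 2 * (((4 : ℕ) : ℝ) + 4)) * α₀) * (1 + 8 * (131072 * (((4 : ℕ) : ℝ) + 1) ^ 2) * (B₁' * (α₀ + α₁))) ≤ 2 ∧
      2 * (B₁' * (α₀ + α₁)) ≤ c3 4 F.L ∧ ((4 : ℕ) : ℝ) * F.L * α₁ ≤ 1 / 8 ∧ α₀ ≤ cP ∧ α₁ ≤ cP ∧ B₁' * (α₀ + α₁) ≤ cP ∧
      2 * (B₁' * (α₀ + α₁)) ^ 2 + 20 * ((4 : ℕ) : ℝ) * α₀ * (B₁' * (α₀ + α₁)) + 2 * C₂ * (B₁' * (α₀ + α₁)) ^ 2 ≤ α₀ + α₁)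
    {α : ℝ} (hα : 0 < α) (hα1 : α ≤ c₁' / 177) (hα2 : α ≤ o.Λ₁ / (1770 * (5 * ((4 : ℕ) : ℝ) * F.L * inp.B₀) + 1))
    (hα3 : α ≤ c2' 4 F.L / 2) (hα5 : α ≤ 1 / 10 ^ 9)
    (hε : o.ε < α) (hΛ₁ : 0 < o.Λ₁) (hΛ₂' : 177 * α * (5 * ((4 : ℕ) : ℝ) * F.L * B₀β + 5 * ((4 : ℕ) : ℝ) * F.L * inp.B₀) ≤ o.Λ₂')
    {b' c' : ℝ} (hb' : 0 ≤ b') (hc' : 0 ≤ c')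
    (hRb : 2 ^ 15 * ((4 : ℝ) + 1) ^ 2 * ((4 : ℝ) + 4) ^ 2 * (F.L : ℝ) ^ 2 * b' ≤ 1)
    (hcF : 23040 * (4 : ℝ) ^ 4 * (frameC 4 F.L + 4) ^ 3 * (c' + curConst 4 F.L * b' ^ 2) ≤ 1)
    (hXα : b' + 226 * (8 * ((4 : ℝ) + 1) * ((4 : ℝ) + 4)) ^ 2 * b' ^ 2 < α) (hY : 4 * ((4 : ℝ) - 1) * (c' + curConst 4 F.L * b' ^ 2) < α) :
    letI : CStarAlgebra (Matrix (Fin N) (Fin N) ℂ) := {}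
    B8.Thm4Body c₁ B₁' (fun i : {i : ZdIdx 4 F.L // i.Ω 0 = Set.univ} => (zdGF3 (Matrix (Fin N) (Fin N) ℂ) F.L β len i.1).toGFData) →
      B8.Prop3Body cP 4 (F.L : ℝ) C₂ inp B₀β
        (fun i : {i : ZdIdx 4 F.L // i.Ω 0 = Set.univ} => (zdGF3 (Matrix (Fin N) (Fin N) ℂ) F.L β len i.1).toGFData2) →
      LeafH3sup 4 F.L o.Nper o.ε b' c' o.dom →
      LeafSlotHolder (ne3OfRecord₁₁ F o) β := by
  letI : CStarAlgebra (Matrix (Fin N) (Fin N) ℂ) := {}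
  intro hT hP h3
  have hL0 : (0 : ℝ) < F.L := by have := HistoryFlow.two_le_L F; positivity
  have hB0 : 0 < 5 * ((4 : ℕ) : ℝ) * F.L * inp.B₀ := by have := inp.B₀_pos; positivity
  have h16' : 16 * (B₁' * c₁') ≤ 1 := by
    obtain ⟨-, -, -, h, -⟩ := hwin (c₁' / 2) (c₁' / 2) (by linarith) (by linarith) (by linarith)
    rwa [add_halves] at h
  obtain ⟨h16, hA3, hA2, hAs, hAc, hMcα, hC335, hss, hgrad, hℓ, hhol⟩ :=
    slotLetterLines F.L (c' + curConst 4 F.L * b' ^ 2) hα hα1 hα2 hα3 hα5 hB0 hBB hc₁' h16' hΛ₁ hΛ₂' hXα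
  exact ⟨len, c₁, c₁', B₁', cP, C₂, B₀β, inp, _, _, b', c', α, 0, 1, fun _ => ∅, hlen, hlen1, hB₁', hBB, rfl, rfl, h16, hwin,
    hb', hc', hRb, hcF, hα, hA3, hA2, hAs, hAc, hXα, hY, le_rfl, hMcα, fun _ _ hq => hq.elim, hC335, hε, hss, hgrad, hℓ, hhol, hT, hP, h3⟩

omit [NeZero N] in
/-- **THE WINDOW RECIPE AT EXPONENT `β`, LINEAR** (dag-ref-B READ-445): N07's leaf letters `0 ≤ b' ≤ α∕2048`, `0 ≤ c' ≤ α∕24`; the class radius `o.ε < α` free, so N07's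
linear leaf `b' = c' = C·ε` is admissible at `ε ≤ α∕(2048·C)` (file 17's `leafLines_of_linear`). [folklore] -/
theorem leafSlotHolder_ofRecord_of_window_linear (F : T4Family) (o : NE3Objects₁₁ N) {β : ℝ}
    {len : Site 4 → ℝ} (hlen : ∀ v : Site 4, 0 < len v → 1 ≤ len v) (hlen1 : ∀ μ : Fin 4, len (e μ) = 1)
    {c₁ c₁' B₁' cP C₂ B₀β : ℝ} {inp : B8.B9Inputs} (hB₁' : 0 < B₁') (hBB : 5 * ((4 : ℕ) : ℝ) * F.L * inp.B₀ ≤ B₁') (hc₁' : 0 < c₁')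
    (hwin : ∀ α₀ α₁ : ℝ, 0 < α₀ → 0 < α₁ → α₀ + α₁ ≤ c₁' →
      α₀ + α₁ ≤ c₁ ∧ C0 4 * (2 * α₀) ≤ 1 / 3 ∧ 4 * α₀ ≤ c2' 4 F.L ∧ 16 * (B₁' * (α₀ + α₁)) ≤ 1 ∧
      Real.exp (4 * (800 * (((4 : ℕ) : ℝ) + 1) ^ 2 * (((4 : ℕ) : ℝ) + 4)) * α₀) * (1 + 8 * (131072 * (((4 : ℕ) : ℝ) + 1) ^ 2) * (B₁' * (α₀ + α₁))) ≤ 2 ∧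
      2 * (B₁' * (α₀ + α₁)) ≤ c3 4 F.L ∧ ((4 : ℕ) : ℝ) * F.L * α₁ ≤ 1 / 8 ∧ α₀ ≤ cP ∧ α₁ ≤ cP ∧ B₁' * (α₀ + α₁) ≤ cP ∧
      2 * (B₁' * (α₀ + α₁)) ^ 2 + 20 * ((4 : ℕ) : ℝ) * α₀ * (B₁' * (α₀ + α₁)) + 2 * C₂ * (B₁' * (α₀ + α₁)) ^ 2 ≤ α₀ + α₁)
    {α : ℝ} (hα : 0 < α) (hα1 : α ≤ c₁' / 177) (hα2 : α ≤ o.Λ₁ / (1770 * (5 * ((4 : ℕ) : ℝ) * F.L * inp.B₀) + 1))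
    (hα3 : α ≤ c2' 4 F.L / 2) (hα4 : α ≤ 1 / ((23040 * (4 : ℝ) ^ 4 * (frameC 4 F.L + 4) ^ 3 + 12) * (1 + curConst 4 F.L) + 1))
    (hα5 : α ≤ 1 / 10 ^ 9)
    (hε : o.ε < α) (hΛ₁ : 0 < o.Λ₁) (hΛ₂' : 177 * α * (5 * ((4 : ℕ) : ℝ) * F.L * B₀β + 5 * ((4 : ℕ) : ℝ) * F.L * inp.B₀) ≤ o.Λ₂')
    {b' c' : ℝ} (hb' : 0 ≤ b') (hb'α : b' ≤ α / 2048) (hc' : 0 ≤ c') (hc'α : c' ≤ α / 24) :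
    letI : CStarAlgebra (Matrix (Fin N) (Fin N) ℂ) := {}
    B8.Thm4Body c₁ B₁' (fun i : {i : ZdIdx 4 F.L // i.Ω 0 = Set.univ} => (zdGF3 (Matrix (Fin N) (Fin N) ℂ) F.L β len i.1).toGFData) →
      B8.Prop3Body cP 4 (F.L : ℝ) C₂ inp B₀β
        (fun i : {i : ZdIdx 4 F.L // i.Ω 0 = Set.univ} => (zdGF3 (Matrix (Fin N) (Fin N) ℂ) F.L β len i.1).toGFData2) →
      LeafH3sup 4 F.L o.Nper o.ε b' c' o.dom →
      LeafSlotHolder (ne3OfRecord₁₁ F o) β :=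
  have h := leafLines_of_linear (le_trans one_le_two (HistoryFlow.two_le_L F)) hα hα3 hα4 hα5 hb' hb'α hc'α
  leafSlotHolder_ofRecord_of_window_lines F o hlen hlen1 hB₁' hBB hc₁' hwin hα hα1 hα2 hα3 hα5 hε hΛ₁ hΛ₂' hb' hc' h.1 h.2.1 h.2.2.1 h.2.2.2

/-- **THE H-PROVISO AT WINDOWED LETTERS**: file 13's `inEndRegime_ofRecord_of_window` at (E)'s β-uniform thresholds — period `≥ 1`, positive coupling letter, class radius
`0 < o.ε < α ≤ o.Λ₁∕(1770·B+1)` (any `B ≥ 0`), `o.Λ₁ ≤ radiusOfRecordH N F.L o.Nper`, `0 ≤ o.b ≤ o.ε∕2`, `constOfRecordH … ≤ o.C` ⇒ `InEndRegimeH (ne3OfRecord₁₁ F o)`.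
[folklore] -/
theorem inEndRegimeH_ofRecord_of_window (F : T4Family) (o : NE3Objects₁₁ N) (hN : 1 ≤ o.Nper) (hg : 0 < o.g) {B : ℝ} (hB : 0 ≤ B) {α : ℝ}
    (hα2 : α ≤ o.Λ₁ / (1770 * B + 1)) (hε0 : 0 < o.ε) (hε : o.ε < α) (hΛ₁r : o.Λ₁ ≤ radiusOfRecordH N F.L o.Nper)
    (hb0 : 0 ≤ o.b) (hb : o.b ≤ o.ε / 2) (hC : constOfRecordH N F.L o.Nper o.g ≤ o.C) :
    InEndRegimeH (ne3OfRecord₁₁ F o) := by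
  have hden : 0 < 1770 * B + 1 := by positivity
  have hαΛ : α * (1770 * B + 1) ≤ o.Λ₁ := (le_div_iff₀ hden).1 hα2
  have hα : 0 < α := hε0.trans hε
  have hαΛ' : α ≤ o.Λ₁ := by nlinarith only [hαΛ, hB, hα]
  have hΛ₁ : 0 ≤ o.Λ₁ := by linarith only [hα, hαΛ']
  have hεr : o.ε ≤ radiusOfRecordH N F.L o.Nper := by linarith only [hε, hαΛ', hΛ₁r]
  exact (inEndRegimeH_iff (ne3OfRecord₁₁ F o)).2 ⟨HistoryFlow.two_le_L F, hN, hg, hε0, hεr, hΛ₁, hΛ₁r, hb0, hb, hC⟩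

/-! ## §3 THE N16 LINE AT EXPONENT `β` at the reading of record with windowed letters, linear currency -/

section ReadingOfRecord

variable {β : ℝ} (hβ0 : 0 ≤ β) (hβ1 : β ≤ 1) (Rg : (F : T4Family) → Stage12Params F N → Prop)
  (w1 : (F : T4Family) → (θ : Stage12Params F N) → Node00.W1.ReadingData F (Node00.MatA N) θ.τ9.M)
  (ne2 : (F : T4Family) → Stage12Params F N → (ℕ → ℝ) → List (ULoop F) → ℕ → NE2Objects₁₁)
  (ne1 : (F : T4Family) → Stage12Params F N → (ℕ → ℝ) → List (ULoop F) → NE1pCarriers)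
  (ℓ : T4Family → NE3Letters₁₁)
  -- N05's constants, per family; the averaging letter in N05's window and N07's leaf letters, per family
  {len : T4Family → Site 4 → ℝ} {c₁ c₁' B₁' cP C₂ B₀β : T4Family → ℝ} {inp : T4Family → B8.B9Inputs} {α b' c' : T4Family → ℝ}
  (hlen : ∀ (F : T4Family) (v : Site 4), 0 < len F v → 1 ≤ len F v) (hlen1 : ∀ (F : T4Family) (μ : Fin 4), len F (e μ) = 1)
  (hB₁' : ∀ F, 0 < B₁' F) (hBB : ∀ F : T4Family, 5 * ((4 : ℕ) : ℝ) * F.L * (inp F).B₀ ≤ B₁' F) (hc₁' : ∀ F, 0 < c₁' F)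
  (hwin : ∀ (F : T4Family) (α₀ α₁ : ℝ), 0 < α₀ → 0 < α₁ → α₀ + α₁ ≤ c₁' F →
    α₀ + α₁ ≤ c₁ F ∧ C0 4 * (2 * α₀) ≤ 1 / 3 ∧ 4 * α₀ ≤ c2' 4 F.L ∧ 16 * (B₁' F * (α₀ + α₁)) ≤ 1 ∧
    Real.exp (4 * (800 * (((4 : ℕ) : ℝ) + 1) ^ 2 * (((4 : ℕ) : ℝ) + 4)) * α₀) * (1 + 8 * (131072 * (((4 : ℕ) : ℝ) + 1) ^ 2) * (B₁' F * (α₀ + α₁))) ≤ 2 ∧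
    2 * (B₁' F * (α₀ + α₁)) ≤ c3 4 F.L ∧ ((4 : ℕ) : ℝ) * F.L * α₁ ≤ 1 / 8 ∧ α₀ ≤ cP F ∧ α₁ ≤ cP F ∧ B₁' F * (α₀ + α₁) ≤ cP F ∧
    2 * (B₁' F * (α₀ + α₁)) ^ 2 + 20 * ((4 : ℕ) : ℝ) * α₀ * (B₁' F * (α₀ + α₁)) + 2 * C₂ F * (B₁' F * (α₀ + α₁)) ^ 2 ≤ α₀ + α₁)
  (hα : ∀ F, 0 < α F) (hα1 : ∀ F, α F ≤ c₁' F / 177)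
  (hα2 : ∀ F : T4Family, α F ≤ (ℓ F).Λ₁ / (1770 * (5 * ((4 : ℕ) : ℝ) * F.L * (inp F).B₀) + 1))
  (hα3 : ∀ F : T4Family, α F ≤ c2' 4 F.L / 2)
  (hα4 : ∀ F : T4Family, α F ≤ 1 / ((23040 * (4 : ℝ) ^ 4 * (frameC 4 F.L + 4) ^ 3 + 12) * (1 + curConst 4 F.L) + 1))
  (hα5 : ∀ F, α F ≤ 1 / 10 ^ 9)
  (hg : ∀ F, 0 < (ℓ F).g) (hε0 : ∀ F, 0 < (ℓ F).ε) (hε : ∀ F, (ℓ F).ε < α F)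
  (hΛ₁r : ∀ F : T4Family, (ℓ F).Λ₁ ≤ radiusOfRecordH N F.L (ne3NperOfRecord₁₁ F 0 0))
  (hb : ∀ F, 0 ≤ (ℓ F).b ∧ (ℓ F).b ≤ (ℓ F).ε / 2) (hC : ∀ F : T4Family, constOfRecordH N F.L (ne3NperOfRecord₁₁ F 0 0) (ℓ F).g ≤ (ℓ F).C)
  (hΛ₂' : ∀ F : T4Family, 177 * α F * (5 * ((4 : ℕ) : ℝ) * F.L * B₀β F + 5 * ((4 : ℕ) : ℝ) * F.L * (inp F).B₀) ≤ (ℓ F).Λ₂')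
  (hb' : ∀ F, 0 ≤ b' F ∧ b' F ≤ α F / 2048) (hc' : ∀ F, 0 ≤ c' F ∧ c' F ≤ α F / 24)
include hβ0 hβ1 hlen hlen1 hB₁' hBB hc₁' hwin hα hα1 hα2 hα3 hα4 hα5 hg hε0 hε hΛ₁r hb hC hΛ₂' hb' hc'

omit hβ0 hβ1 in
/-- Per family: the H-proviso and — from the content — the Holder slot, at the windowed letters `ℓ F` (§2 twice, linear currency). [folklore] -/
theorem inEndRegimeH_and_leafSlotHolder_ofRecord_of_window_linear (F : T4Family)
    (hT : letI : CStarAlgebra (Matrix (Fin N) (Fin N) ℂ) := {}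
      B8.Thm4Body (c₁ F) (B₁' F) (fun i : {i : ZdIdx 4 F.L // i.Ω 0 = Set.univ} => (zdGF3 (Matrix (Fin N) (Fin N) ℂ) F.L β (len F) i.1).toGFData))
    (hP : letI : CStarAlgebra (Matrix (Fin N) (Fin N) ℂ) := {}
      B8.Prop3Body (cP F) 4 (F.L : ℝ) (C₂ F) (inp F) (B₀β F)
        (fun i : {i : ZdIdx 4 F.L // i.Ω 0 = Set.univ} => (zdGF3 (Matrix (Fin N) (Fin N) ℂ) F.L β (len F) i.1).toGFData2))
    (h3 : LeafH3sup 4 F.L (ne3NperOfRecord₁₁ F 0 0) (ℓ F).ε (b' F) (c' F) (ne3DomOfRecord₁₁ F N 0 0)) :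
    InEndRegimeH (ne3OfRecord₁₁ F (ne3ConstLayerOfRecord₁₁ F N (ℓ F))) ∧ LeafSlotHolder (ne3OfRecord₁₁ F (ne3ConstLayerOfRecord₁₁ F N (ℓ F))) β := by
  letI : CStarAlgebra (Matrix (Fin N) (Fin N) ℂ) := {}
  have hB0 : 0 < 5 * ((4 : ℕ) : ℝ) * F.L * (inp F).B₀ := by
    have := (inp F).B₀_pos; have := HistoryFlow.two_le_L F; positivity
  refine ⟨inEndRegimeH_ofRecord_of_window F (ne3ConstLayerOfRecord₁₁ F N (ℓ F)) (one_le_ne3NperOfRecord₁₁ F 0 0) (hg F) hB0.le (hα2 F) (hε0 F) (hε F)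
    (hΛ₁r F) (hb F).1 (hb F).2 (hC F), ?_⟩
  -- `0 < Λ₁`: `0 < α ≤ Λ₁∕(1770·B+1) ≤ Λ₁`
  have hΛpos : 0 < (ℓ F).Λ₁ := by
    have hBp : 0 < 1770 * (5 * ((4 : ℕ) : ℝ) * F.L * (inp F).B₀) + 1 := by positivity
    have h := (le_div_iff₀ hBp).1 (hα2 F)
    have hαp : 0 < α F := hα F
    nlinarith only [h, hB0, hαp]
  exact leafSlotHolder_ofRecord_of_window_linear F (ne3ConstLayerOfRecord₁₁ F N (ℓ F)) (hlen F) (hlen1 F) (hB₁' F) (hBB F) (hc₁' F) (hwin F) (hα F) (hα1 F) (hα2 F)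
    (hα3 F) (hα4 F) (hα5 F) (hε F) hΛpos (hΛ₂' F) (hb' F).1 (hb' F).2 (hc' F).1 (hc' F).2 hT hP h3

/-- **THE N16 LINE AT EXPONENT `β ∈ [0, 1]` AT THE READING OF RECORD, REGIME-RESTRICTED HOME, WINDOWED LETTERS** — file 14's `s_N16_rRec₁₂On_readingOfRecord₁₂_of_window`
with N05's family at `zdGF3 (M_N ℂ) F.L β (len F)`, THE END's thresholds (E1)'s β-uniform `radiusOfRecordH` ∕ `constOfRecordH`, N07's leaf letters LINEAR (`b' ≤ α∕2048`, `c' ≤ α∕24`; the displayed letter lines are the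
section's hypotheses), conclusion the Holder stub `S_N16Holder β (RRec₁₂On (readingOfRecord₁₂ w1 ℓ ne2 ne1) Rg)`; the three content clauses once per guarded family are the only
non-letter hypotheses. [folklore] -/
theorem s_N16Holder_rRec₁₂On_readingOfRecord₁₂_of_window_linear
    (hcontent : ∀ (F : T4Family), (∃ θ : Stage12Params F N, θ.Provisos₁₂ F N ∧ Rg F θ ∧ θ.Admissible F N) →
      letI : CStarAlgebra (Matrix (Fin N) (Fin N) ℂ) := {}
      B8.Thm4Body (c₁ F) (B₁' F) (fun i : {i : ZdIdx 4 F.L // i.Ω 0 = Set.univ} => (zdGF3 (Matrix (Fin N) (Fin N) ℂ) F.L β (len F) i.1).toGFData) ∧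
        B8.Prop3Body (cP F) 4 (F.L : ℝ) (C₂ F) (inp F) (B₀β F)
          (fun i : {i : ZdIdx 4 F.L // i.Ω 0 = Set.univ} => (zdGF3 (Matrix (Fin N) (Fin N) ℂ) F.L β (len F) i.1).toGFData2) ∧
        LeafH3sup 4 F.L (ne3NperOfRecord₁₁ F 0 0) (ℓ F).ε (b' F) (c' F) (ne3DomOfRecord₁₁ F N 0 0)) :
    S_N16Holder β (RRec₁₂On (readingOfRecord₁₂ w1 ℓ ne2 ne1) Rg) :=
  s_N16Holder_rRec₁₂On_readingOfRecord₁₂_of_leafSlotHolder hβ0 hβ1 Rg w1 ℓ ne2 ne1 fun F hF =>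
    inEndRegimeH_and_leafSlotHolder_ofRecord_of_window_linear ℓ hlen hlen1 hB₁' hBB hc₁' hwin hα hα1 hα2 hα3 hα4 hα5 hg hε0 hε hΛ₁r hb hC hΛ₂' hb' hc' F
      (hcontent F hF).1 (hcontent F hF).2.1 (hcontent F hF).2.2

/-- **THE N16 LINE AT EXPONENT `β ∈ [0, 1]` AT THE READING OF RECORD, CANONICAL HOME `RRec₁₂`, WINDOWED LETTERS** (content once per family carrying a Stage-12 datum of
record). [folklore] -/
theorem s_N16Holder_rRec₁₂_readingOfRecord₁₂_of_window_linear
    (hcontent : ∀ (F : T4Family), (∃ D : Datum F N, IsDatumOfRecord₁₂C F N D) →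
      letI : CStarAlgebra (Matrix (Fin N) (Fin N) ℂ) := {}
      B8.Thm4Body (c₁ F) (B₁' F) (fun i : {i : ZdIdx 4 F.L // i.Ω 0 = Set.univ} => (zdGF3 (Matrix (Fin N) (Fin N) ℂ) F.L β (len F) i.1).toGFData) ∧
        B8.Prop3Body (cP F) 4 (F.L : ℝ) (C₂ F) (inp F) (B₀β F)
          (fun i : {i : ZdIdx 4 F.L // i.Ω 0 = Set.univ} => (zdGF3 (Matrix (Fin N) (Fin N) ℂ) F.L β (len F) i.1).toGFData2) ∧
        LeafH3sup 4 F.L (ne3NperOfRecord₁₁ F 0 0) (ℓ F).ε (b' F) (c' F) (ne3DomOfRecord₁₁ F N 0 0)) :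
    S_N16Holder β (RRec₁₂ (readingOfRecord₁₂ w1 ℓ ne2 ne1)) :=
  s_N16Holder_rRec₁₂_readingOfRecord₁₂_of_leafSlotHolder hβ0 hβ1 w1 ℓ ne2 ne1 fun F hF =>
    inEndRegimeH_and_leafSlotHolder_ofRecord_of_window_linear ℓ hlen hlen1 hB₁' hBB hc₁' hwin hα hα1 hα2 hα3 hα4 hα5 hg hε0 hε hΛ₁r hb hC hΛ₂' hb' hc' F
      (hcontent F hF).1 (hcontent F hF).2.1 (hcontent F hF).2.2

end ReadingOfRecord

/-! ## §4 The windowed letters, the H-proviso and N21's numerals hold TOGETHER -/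

/-- **THE N16 LINE AT EXPONENT `β` IS LETTER-WISE NON-VACUOUS AT THE H-THRESHOLDS** — file 13's `exists_window_letters_numerals` with `radiusOfRecord ↦ radiusOfRecordH`,
`constOfRecord ↦ constOfRecordH`, `InEndRegime ↦ InEndRegimeH`. [folklore] -/
theorem exists_window_letters_numerals_H (F : T4Family) {c₁' : ℝ} (hc₁' : 0 < c₁') (inp : B8.B9Inputs) (B₀β : ℝ) {g : ℝ} (hg : 0 < g) :
    ∃ (α : ℝ) (ℓ : NE3Letters₁₁),
      0 < α ∧ α ≤ c₁' / 177 ∧ α ≤ ℓ.Λ₁ / (1770 * (5 * ((4 : ℕ) : ℝ) * F.L * inp.B₀) + 1) ∧ α ≤ c2' 4 F.L / 2 ∧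
      α ≤ 1 / ((23040 * (4 : ℝ) ^ 4 * (frameC 4 F.L + 4) ^ 3 + 12) * (1 + curConst 4 F.L) + 1) ∧ α ≤ 1 / 10 ^ 9 ∧
      ℓ.g = g ∧ 0 < ℓ.ε ∧ ℓ.ε < α ∧ ℓ.Λ₁ = radiusOfRecordH N F.L (ne3NperOfRecord₁₁ F 0 0) ∧ 0 < ℓ.b ∧ ℓ.b ≤ ℓ.ε / 2 ∧
      ℓ.C = constOfRecordH N F.L (ne3NperOfRecord₁₁ F 0 0) g ∧
      177 * α * (5 * ((4 : ℕ) : ℝ) * F.L * B₀β + 5 * ((4 : ℕ) : ℝ) * F.L * inp.B₀) ≤ ℓ.Λ₂' ∧ 0 < ℓ.Λ₂' ∧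
      512 * (4 + 1) * (4 + 4) * (F.L : ℝ) ^ 2 * ℓ.b ≤ 1 ∧
      InEndRegimeH (ne3OfRecord₁₁ F (ne3ConstLayerOfRecord₁₁ F N ℓ)) := by
  have hL : 2 ≤ F.L := HistoryFlow.two_le_L F
  have hL0 : (0 : ℝ) < F.L := by exact_mod_cast lt_of_lt_of_le one_pos (le_trans one_le_two hL)
  have hB₀ := inp.B₀_pos
  obtain ⟨r, hr_def, hr⟩ : ∃ r : ℝ, r = radiusOfRecordH N F.L (ne3NperOfRecord₁₁ F 0 0) ∧ 0 < r :=
    ⟨_, rfl, radiusOfRecordH_pos hL (one_le_ne3NperOfRecord₁₁ F 0 0)⟩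
  obtain ⟨B, hB_def, hB0⟩ : ∃ B : ℝ, B = 5 * ((4 : ℕ) : ℝ) * F.L * inp.B₀ ∧ 0 < B := ⟨_, rfl, by positivity⟩
  obtain ⟨M, hM_def, hM0⟩ : ∃ M : ℝ, M = 23040 * (4 : ℝ) ^ 4 * (frameC 4 F.L + 4) ^ 3 ∧ 0 ≤ M :=
    ⟨_, rfl, by have : 0 ≤ frameC 4 F.L := by unfold frameC; positivity
                positivity⟩
  have hcur : 0 ≤ curConst 4 F.L := curConst_nonneg (d := 4) F.L
  have hc2 : 0 < c2' 4 F.L := c2'_pos 4 F.L (le_trans one_le_two hL)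
  obtain ⟨α, hα, hα1, hα2, hα3, hα4, hα5⟩ : ∃ α : ℝ, 0 < α ∧ α ≤ c₁' / 177 ∧ α ≤ r / (1770 * B + 1) ∧ α ≤ c2' 4 F.L / 2 ∧
      α ≤ 1 / ((M + 12) * (1 + curConst 4 F.L) + 1) ∧ α ≤ 1 / 10 ^ 9 := by
    refine ⟨min (min (c₁' / 177) (r / (1770 * B + 1))) (min (c2' 4 F.L / 2) (min (1 / ((M + 12) * (1 + curConst 4 F.L) + 1)) (1 / 10 ^ 9))),
      lt_min (lt_min (by positivity) (by positivity)) (lt_min (by positivity) (lt_min (by positivity) (by norm_num))), ?_, ?_, ?_, ?_, ?_⟩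
    · exact (min_le_left _ _).trans (min_le_left _ _)
    · exact (min_le_left _ _).trans (min_le_right _ _)
    · exact (min_le_right _ _).trans (min_le_left _ _)
    · exact (min_le_right _ _).trans ((min_le_right _ _).trans (min_le_left _ _))
    · exact (min_le_right _ _).trans ((min_le_right _ _).trans (min_le_right _ _))
  have hαr : α ≤ r := hα2.trans (div_le_self hr.le (by linarith only [hB0]))
  have hK : 0 < 512 * (4 + 1) * (4 + 4) * (F.L : ℝ) ^ 2 := by positivity
  obtain ⟨b, hb_def, hb0, hb1, hb2⟩ : ∃ b : ℝ, b = min (α / 4) (1 / (512 * (4 + 1) * (4 + 4) * (F.L : ℝ) ^ 2)) ∧ 0 < b ∧ b ≤ α / 4 ∧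
      b ≤ 1 / (512 * (4 + 1) * (4 + 4) * (F.L : ℝ) ^ 2) :=
    ⟨_, rfl, lt_min (by positivity) (by positivity), min_le_left _ _, min_le_right _ _⟩
  refine ⟨α, ⟨α / 2, b, g, constOfRecordH N F.L (ne3NperOfRecord₁₁ F 0 0) g, r,
      max 1 (177 * α * (5 * ((4 : ℕ) : ℝ) * F.L * B₀β + 5 * ((4 : ℕ) : ℝ) * F.L * inp.B₀))⟩,
    hα, hα1, ?_, hα3, ?_, hα5, rfl, half_pos hα, half_lt_self hα, hr_def, hb0, ?_, rfl, le_max_right _ _, lt_max_of_lt_left one_pos, ?_, ?_⟩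
  · change α ≤ r / (1770 * (5 * ((4 : ℕ) : ℝ) * F.L * inp.B₀) + 1)
    rw [← hB_def]; exact hα2
  · rw [← hM_def]; exact hα4
  · change b ≤ α / 2 / 2
    linarith only [hb1]
  · calc 512 * (4 + 1) * (4 + 4) * (F.L : ℝ) ^ 2 * b
        ≤ 512 * (4 + 1) * (4 + 4) * (F.L : ℝ) ^ 2 * (1 / (512 * (4 + 1) * (4 + 4) * (F.L : ℝ) ^ 2)) := mul_le_mul_of_nonneg_left hb2 hK.le
      _ = 1 := by field_simp
  · refine (inEndRegimeH_iff _).2 ⟨hL, one_le_ne3NperOfRecord₁₁ F 0 0, hg, half_pos hα, ?_, hr.le, hr_def.le, hb0.le, ?_, le_rfl⟩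
    · change α / 2 ≤ radiusOfRecordH N F.L (ne3NperOfRecord₁₁ F 0 0)
      rw [← hr_def]; linarith only [hαr, hα]
    · change b ≤ α / 2 / 2
      linarith only [hb1]

end

end Summit.QuantumFields.YangMills.BalabanUVNodes.N16HolderSlotWindow
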